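import Literature.Uncategorized.KickMatchedMeasurable
import Literature.MathematicalPhysics.KineticTheory.KickMatchedMeasurable
import HarnessLib

/-!
# KickMatchedMeasurable — discharge (DEPRECATED ALIASES; moved to `MathematicalPhysics/KineticTheory`)

Librarian move 2026-08-16: every lemma below and the discharge now live VERBATIM in
`Literature/MathematicalPhysics/KineticTheory/KickMatchedMeasurable.lean` (p93470); this module keeps the old
names as `@[deprecated]` aliases (no importer uses them; kept per the never-delete rule). Original description:

Topic `Literature/Uncategorized`. Sibling proof file of `Literature.Uncategorized.KickMatchedMeasurable` (the named
fact W1 of the kick-matched hard-sphere gas `Z*`, `Literature/MathematicalPhysics/KineticTheory/KickMatchedHardSphereGas`):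
for every `0 < σ < 1/2`, `N`, `t`, the time-`t` map `(z, u) ↦ kmFlow σ N u z t` is jointly measurable in (datum, dice).

## The (folklore) argument, as formalized

`kmFlow σ N = Driven.flow geo (hsDiameter σ N) (kmRule σ N)` is the library's noise-driven collision recursion, whose
time-`t` map is jointly measurable for a hard-sphere regular, measurable geometry and a jointly measurable rule
(`Driven.measurable_flow`, `StochasticCollisionHardSphereProcess`). The torus geometry is measurable
(`Torus.isMeasurable_geometry`) and regular at every diameter `< 1/2` (`Torus.isHardSphereRegular_geometry`; here
`hsDiameter σ N ≤ σ < 1/2`, `hsDiameter_le`). It remains to see that `kmRule σ N i j y d = kickAt σ N i j (kmNormal …) y`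
is jointly measurable in `(y, d)` (`measurableRule_kmRule`):

* `measurable_lambertLift₂` — Lambert's lift `(ω, q) ↦ Lambert.lift ω q` is JOINTLY Borel (the polar frame `e₁, e₂` is
  piecewise algebraic with a constant fallback on the measurable pole set `rho ω = 0`); the tree only had
  `Lambert.measurable_lift a` for a fixed axis (`LambertCosineLaw`), whereas `kmNormal` lifts about the datum-dependent
  axis `a = (w − v)/|w − v|`.
* `measurable_kickAt` — `kickAt` is `collidePair` (`Geometry.IsMeasurable.measurable_collidePair`) after a
  `Function.update` of the partner by a measurable translate (`measurable_update'`).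
* `measurableSet_isAdmissible` — a norm condition, an open half-space condition, and the preimage of the measurable
  hard-sphere domain (`measurableSet_hardSphereDomain`) under the measurable kick.
* `measurable_dite_find` — the abstract rejection sampler `x ↦ if h : ∃ n, P n x then F (Nat.find h) x else J x` is
  measurable for measurable events/branches (`Measurable.find` on the success set, `measurable_of_restrict_of_restrict_compl`),
  for arbitrary decidability instances; `measurable_kmNormal` is this with the events
  `‖d n‖ ≤ 1 ∧ IsAdmissible … (Lambert.lift a (d n)) y`.

A parallel problem-side proof exists in
`Summits/AtomisticToContinuum/HydrodynamicLimit/Theorems/InformationPercolationEnginePercolationClosesChaosKickMatchedMeasurable.lean`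
(`stub_kickMatchedMeasurable`, p77698); Literature cannot import Summits, so the discharge is re-proved here upstream and
that stub may be shortened to `KickMatchedMeasurable_holds`.

## References

Standard measure theory (measurability of piecewise-defined maps, of `Nat.find` first-hit selections —
`Measurable.find` in Mathlib — and of compositions); the collision recursion of C. Cercignani, R. Illner,
M. Pulvirenti, *The Mathematical Theory of Dilute Gases* (1994), App. 4.A, in its noise-driven form `Driven.flow`.
Every declaration is `[folklore]`.
-/

namespace Literature.Uncategorized

/-- Deprecated alias (moved to `Literature.MathematicalPhysics.KineticTheory.measurable_lambertRho`, same statement and proof).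
[folklore] -/
@[deprecated Literature.MathematicalPhysics.KineticTheory.measurable_lambertRho (since := "2026-08-16")]
alias measurable_lambertRho := Literature.MathematicalPhysics.KineticTheory.measurable_lambertRho

/-- Deprecated alias (moved to `Literature.MathematicalPhysics.KineticTheory.measurable_lambertE₁`, same statement and proof).
[folklore] -/
@[deprecated Literature.MathematicalPhysics.KineticTheory.measurable_lambertE₁ (since := "2026-08-16")]
alias measurable_lambertE₁ := Literature.MathematicalPhysics.KineticTheory.measurable_lambertE₁

/-- Deprecated alias (moved to `Literature.MathematicalPhysics.KineticTheory.measurable_lambertE₂`, same statement and proof).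
[folklore] -/
@[deprecated Literature.MathematicalPhysics.KineticTheory.measurable_lambertE₂ (since := "2026-08-16")]
alias measurable_lambertE₂ := Literature.MathematicalPhysics.KineticTheory.measurable_lambertE₂

/-- Deprecated alias (moved to `Literature.MathematicalPhysics.KineticTheory.measurable_lambertEmbed₂`, same statement and proof).
[folklore] -/
@[deprecated Literature.MathematicalPhysics.KineticTheory.measurable_lambertEmbed₂ (since := "2026-08-16")]
alias measurable_lambertEmbed₂ := Literature.MathematicalPhysics.KineticTheory.measurable_lambertEmbed₂

/-- Deprecated alias (moved to `Literature.MathematicalPhysics.KineticTheory.measurable_lambertLift₂`, same statement and proof).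
[folklore] -/
@[deprecated Literature.MathematicalPhysics.KineticTheory.measurable_lambertLift₂ (since := "2026-08-16")]
alias measurable_lambertLift₂ := Literature.MathematicalPhysics.KineticTheory.measurable_lambertLift₂

/-- Deprecated alias (moved to `Literature.MathematicalPhysics.KineticTheory.measurable_kickAt`, same statement and proof).
[folklore] -/
@[deprecated Literature.MathematicalPhysics.KineticTheory.measurable_kickAt (since := "2026-08-16")]
alias measurable_kickAt := Literature.MathematicalPhysics.KineticTheory.measurable_kickAt

/-- Deprecated alias (moved to `Literature.MathematicalPhysics.KineticTheory.measurableSet_isAdmissible`, same statement and proof).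
[folklore] -/
@[deprecated Literature.MathematicalPhysics.KineticTheory.measurableSet_isAdmissible (since := "2026-08-16")]
alias measurableSet_isAdmissible := Literature.MathematicalPhysics.KineticTheory.measurableSet_isAdmissible

/-- Deprecated alias (moved to `Literature.MathematicalPhysics.KineticTheory.measurable_dite_find`, same statement and proof).
[folklore] -/
@[deprecated Literature.MathematicalPhysics.KineticTheory.measurable_dite_find (since := "2026-08-16")]
alias measurable_dite_find := Literature.MathematicalPhysics.KineticTheory.measurable_dite_find

/-- Deprecated alias (moved to `Literature.MathematicalPhysics.KineticTheory.measurable_kmNormal`, same statement and proof).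
[folklore] -/
@[deprecated Literature.MathematicalPhysics.KineticTheory.measurable_kmNormal (since := "2026-08-16")]
alias measurable_kmNormal := Literature.MathematicalPhysics.KineticTheory.measurable_kmNormal

/-- Deprecated alias (moved to `Literature.MathematicalPhysics.KineticTheory.measurableRule_kmRule`, same statement and proof).
[folklore] -/
@[deprecated Literature.MathematicalPhysics.KineticTheory.measurableRule_kmRule (since := "2026-08-16")]
alias measurableRule_kmRule := Literature.MathematicalPhysics.KineticTheory.measurableRule_kmRule

-- `linter.deprecated` off for this declaration only (lint debt, justified): its TYPE is the deprecated
-- old name `Literature.Uncategorized.KickMatchedMeasurable`, which must stay the stated type so that the old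
-- named fact remains formally discharged until its last importer is re-pointed.
set_option linter.deprecated false in
/-- Discharge of the (deprecated) old name: definitionally the discharge
`Literature.MathematicalPhysics.KineticTheory.KickMatchedMeasurable_holds` of the moved fact. [folklore] -/
@[deprecated Literature.MathematicalPhysics.KineticTheory.KickMatchedMeasurable_holds (since := "2026-08-16")]
theorem KickMatchedMeasurable_holds : KickMatchedMeasurable :=
  Literature.MathematicalPhysics.KineticTheory.KickMatchedMeasurable_holds

end Literature.Uncategorized
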